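import Literature.NumberTheory.EllipticCurves.KubertTateFiveMuDescentBox
import Literature.NumberTheory.EllipticCurves.KubertTateFiveRationalTorsion
import HarnessLib

/-!
# `t₅ = 0` at rank `2` by descent alone: the Kubert–Tate curve `E_{28/9} = [-19, -252, -2268, 0, 0]`

PROOF-ONLY file (theorems only, no definition, no named fact, no `sorry`), topic
`NumberTheory/EllipticCurves`; an INSTANCE of the `μ₅`-descent box criterion
(`KubertTateMuDescent.shaCorank_five_eq_zero_of_matrix` and siblings, files
`KubertTateFiveMuDescent[Box]`) on the Kubert–Tate `X₁(5)`-family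
`E_{m,n} : y² + (n − m)xy − mn²y = x³ − mnx²`, at `(m, n) = (28, 9)`:

  `E = E_{28/9} = kubertTateFive (28) 9 = [-19, -252, -2268, 0, 0]`, i.e. `y ^ 2 - 19 * x * y - 2268 * y = x ^ 3 - 252 * x ^ 2`,
  `Δ = -2^10·3^10·7^5·2069`, `T = (0,0)` of order `5`, `5` good ORDINARY (`a₅ = -4`).

TAME: `5 ∤ Δ` and the bad primes `2, 3, 7, 2069` are `≢ 1 (mod 5)`. BOX: `S = {2, 3, 7}`
(`ω(mn) = 3`); the rational points `(0, 2268)`, `(-36, 1296)`, `(-42, 882)` (found by a naive search)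
have `f_T = xy − 9x² + 81y` equal to `183708`, `46656`, `18522`, the base point `2T = (252, 7056)` has
`f_T = 1778112`; the `3×3` matrix of valuation differences mod `5`, `M = [[1, 4, 3], [0, 2, 2], [0, 4, 0]]`, is invertible mod `5`
(inverse `[[1, 1, 1], [0, 0, 4], [0, 3, 1]]`). Hence, with NO `L`-function, `p`-adic or conjectural input:

* `shaCorank_five_eq_zero` — **`t₅(E_{28/9}) = corank_{ℤ₅} Ш(E/ℚ)[5^∞] = 0`**;
* `sha_torsionBy_five_eq_bot` — `Ш(E/ℚ)[5] = 0`; `primaryComponent_sha_five_eq_bot` — `Ш(E/ℚ)[5^∞] = 0`;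
* `mordellWeilRank_eq` — **`rank E_{28/9}(ℚ) = 2`** (with `#E(ℚ)[5] = 5` by reduction modulo `11`,
  `KubertTateFiveTorsion.natCard_torsionBy_five`).

## References

* [SilvermanAEC2009] J. H. Silverman, *AEC*, 2nd ed., Thm. X.4.2, Prop. X.4.9, Exercise 10.1, Thm. X.1.1,
  VII.3.1(b).
* [Fisher2001FiveSevenDescent] T. Fisher, *Some examples of 5 and 7 descent for elliptic curves over ℚ*,
  JEMS 3 (2001), §§1–2 (the family; this member and its points are ours, verified in-file).
* [Kubert1976] D. S. Kubert, *Universal bounds on the torsion of elliptic curves*, Table 3 (`N = 5`).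
-/

noncomputable section

open scoped AddSubgroup
open WeierstrassCurve
open Literature.NumberTheory.EllipticCurves Literature.NumberTheory.EllipticCurves.KubertTateVelu

namespace Literature.NumberTheory.EllipticCurves

namespace KubertTate289Descent

/-! ## §1 The curve: coefficients, discriminant, tameness -/

/-- `E_{28/9} = [-19, -252, -2268, 0, 0]`. [cite: Kubert1976, Table 3 (N = 5)] -/
theorem curve_eq : kubertTateFive (((28 : ℤ) : ℚ)) (((9 : ℤ) : ℚ)) = ⟨-19, -252, -2268, 0, 0⟩ := by
  ext <;> simp [kubertTateFive] <;> norm_num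

/-- `Δ(E_{28/9}) = -2102631636446208` (integer model). [cite: Kubert1976, Table 3 (N = 5)] -/
theorem Δ_int : (kubertTateFive (28 : ℤ) 9).Δ = -2102631636446208 := by
  rw [kubertTateFive_Δ]; norm_num

/-- `E_{28/9}` is an elliptic curve (`Δ ≠ 0`). [cite: Kubert1976, Table 3 (N = 5)] -/
theorem isElliptic : (kubertTateFive (((28 : ℤ) : ℚ)) (((9 : ℤ) : ℚ))).IsElliptic := by
  refine ⟨isUnit_iff_ne_zero.mpr ?_⟩
  rw [eq_map_int (28) 9, map_Δ, Δ_int]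
  norm_num

/-- `5 ∤ Δ`: good reduction at `5`. [cite: Fisher2001FiveSevenDescent, §2] -/
theorem not_five_dvd_Δ : ¬ (5 : ℤ) ∣ (kubertTateFive (28 : ℤ) 9).Δ := by
  rw [Δ_int]; norm_num

/-- `11 ∤ Δ`: good reduction at `11` (used for the rational torsion). [cite: SilvermanAEC2009, VII.3.1(b)] -/
theorem not_tor_dvd_Δ : ¬ ((11 : ℕ) : ℤ) ∣ (kubertTateFive (28 : ℤ) 9).Δ := by
  rw [Δ_int]; norm_num

/-- **TAME**: every bad prime (`2, 3, 7, 2069`) is `≢ 1 (mod 5)`. [cite: Fisher2001FiveSevenDescent, §2] -/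
theorem tame : ∀ p : ℕ, p.Prime → (p : ℤ) ∣ (kubertTateFive (28 : ℤ) 9).Δ → p % 5 ≠ 1 := by
  intro p hp hdvd
  rw [Δ_int] at hdvd
  have hdvdN : p ∣ 2 ^ 10 * 3 ^ 10 * 7 ^ 5 * 2069 := by
    have h' : (p : ℤ) ∣ ((2 ^ 10 * 3 ^ 10 * 7 ^ 5 * 2069 : ℕ) : ℤ) := by
      have e : ((2 ^ 10 * 3 ^ 10 * 7 ^ 5 * 2069 : ℕ) : ℤ) = 2102631636446208 := by norm_num
      rw [e]; exact (Int.dvd_neg.mpr hdvd)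
    exact Int.natCast_dvd_natCast.mp h'
  have hpi := Nat.Prime.prime hp
  rcases hpi.dvd_or_dvd hdvdN with h | h
  · rcases hpi.dvd_or_dvd h with h | h
    · rcases hpi.dvd_or_dvd h with h | h
      · have := (Nat.prime_dvd_prime_iff_eq hp Nat.prime_two).mp (hpi.dvd_of_dvd_pow h); omega
      · have := (Nat.prime_dvd_prime_iff_eq hp Nat.prime_three).mp (hpi.dvd_of_dvd_pow h); omega
    · have := (Nat.prime_dvd_prime_iff_eq hp (by norm_num : Nat.Prime 7)).mp (hpi.dvd_of_dvd_pow h); omega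
  · have := (Nat.prime_dvd_prime_iff_eq hp (by norm_num : Nat.Prime 2069)).mp h; omega

/-- `S = ` the prime factors of `|mn| = 252`: `{2, 3, 7}`. [folklore] -/
private theorem primeFactors_eq : ((28 : ℤ) * 9).natAbs.primeFactors = {2, 3, 7} := by
  have e : ((28 : ℤ) * 9).natAbs = 2 ^ 2 * 3 ^ 2 * 7 := by norm_num
  rw [e]
  ext p
  simp only [Nat.mem_primeFactors, Finset.mem_insert, Finset.mem_singleton]
  constructor
  · rintro ⟨hp, hdvd, -⟩
    have hpi := Nat.Prime.prime hp
    rcases hpi.dvd_or_dvd hdvd with h | h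
    · rcases hpi.dvd_or_dvd h with h | h
      · exact Or.inl ((Nat.prime_dvd_prime_iff_eq hp Nat.prime_two).mp (hpi.dvd_of_dvd_pow h))
      · exact Or.inr (Or.inl ((Nat.prime_dvd_prime_iff_eq hp Nat.prime_three).mp (hpi.dvd_of_dvd_pow h)))
    · exact Or.inr (Or.inr ((Nat.prime_dvd_prime_iff_eq hp (by norm_num : Nat.Prime 7)).mp h))
  · rintro (rfl | rfl | rfl) <;> norm_num

/-! ## §2 The affine equation and the points -/

/-- The affine equation of `E_{28/9}`: `y ^ 2 - 19 * x * y - 2268 * y = x ^ 3 - 252 * x ^ 2`. [cite: Kubert1976, Table 3 (N = 5)] -/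
theorem nonsingular_iff (x y : ℚ) :
    (kubertTateFive (((28 : ℤ) : ℚ)) (((9 : ℤ) : ℚ))).toAffine.Nonsingular x y ↔
      y ^ 2 - 19 * x * y - 2268 * y = x ^ 3 - 252 * x ^ 2 := by
  have hΔ : (kubertTateFive (((28 : ℤ) : ℚ)) (((9 : ℤ) : ℚ))).Δ ≠ 0 := isElliptic.isUnit.ne_zero
  rw [← Affine.equation_iff_nonsingular_of_Δ_ne_zero hΔ, Affine.equation_iff]
  simp only [kubertTateFive_a₁, kubertTateFive_a₂, kubertTateFive_a₃, kubertTateFive_a₄,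
    kubertTateFive_a₆]
  push_cast
  constructor <;> intro h <;> linear_combination h

/-- The points `(0, 2268)`, `(-36, 1296)`, `(-42, 882)` and the base point `2T = (252, 7056)` lie on `E_{28/9}`
(checked by `norm_num`). [folklore] -/
private theorem nonsingular_points :
    (kubertTateFive (((28 : ℤ) : ℚ)) (((9 : ℤ) : ℚ))).toAffine.Nonsingular 0 2268 ∧
    (kubertTateFive (((28 : ℤ) : ℚ)) (((9 : ℤ) : ℚ))).toAffine.Nonsingular (-36) 1296 ∧
    (kubertTateFive (((28 : ℤ) : ℚ)) (((9 : ℤ) : ℚ))).toAffine.Nonsingular (-42) 882 ∧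
    (kubertTateFive (((28 : ℤ) : ℚ)) (((9 : ℤ) : ℚ))).toAffine.Nonsingular 252 7056 := by
  refine ⟨(nonsingular_iff _ _).mpr ?_, (nonsingular_iff _ _).mpr ?_, (nonsingular_iff _ _).mpr ?_, (nonsingular_iff _ _).mpr ?_⟩ <;> norm_num

/-! ## §3 The valuation matrix -/

/-- `v_p(± p^k u) = k` for `p ∤ u` (evaluation of `padicValRat` on a factorised integer). [folklore] -/
private theorem padicValRat_eq_of_eq {p : ℕ} [hp : Fact p.Prime] {a : ℚ} (k : ℕ) {u : ℕ} (s : ℤ)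
    (hs : s = 1 ∨ s = -1) (hu : ¬ p ∣ u) (h : a = s * (p : ℚ) ^ k * u) : padicValRat p a = k := by
  have hu0 : u ≠ 0 := by rintro rfl; exact hu (dvd_zero p)
  have hp0 : (p : ℚ) ≠ 0 := Nat.cast_ne_zero.mpr hp.out.ne_zero
  have hs0 : (s : ℚ) ≠ 0 := by rcases hs with rfl | rfl <;> norm_num
  have hsv : padicValRat p (s : ℚ) = 0 := by
    rcases hs with rfl | rfl
    · simp
    · rw [Int.cast_neg, Int.cast_one, padicValRat.neg, padicValRat.one]
  rw [h, padicValRat.mul (mul_ne_zero hs0 (pow_ne_zero _ hp0)) (Nat.cast_ne_zero.mpr hu0),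
    padicValRat.mul hs0 (pow_ne_zero _ hp0), hsv, padicValRat.pow (p : ℚ),
    padicValRat.self hp.out.one_lt, padicValRat.of_nat, padicValNat.eq_zero_of_not_dvd hu]
  simp

/-- The `f_T`-values `f_T = xy − 9x² + 81y` of the points (`183708`, `46656`, `18522`) and of the base point
`2T` (`1778112`). [cite: SilvermanAEC2009, Exercise 10.1(c)] -/
theorem kummerValues :
    (∀ i : Fin 3, ![(0 : ℚ), -36, -42] i * ![(2268 : ℚ), 1296, 882] i - (((9 : ℤ) : ℚ)) * ![(0 : ℚ), -36, -42] i ^ 2 +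
      (((9 : ℤ) : ℚ)) ^ 2 * ![(2268 : ℚ), 1296, 882] i = ![(183708 : ℚ), 46656, 18522] i) ∧
    ((252 : ℚ) * 7056 - (((9 : ℤ) : ℚ)) * (252) ^ 2 + (((9 : ℤ) : ℚ)) ^ 2 * 7056 = (1778112 : ℚ)) := by
  refine ⟨fun i ↦ ?_, by norm_num⟩
  fin_cases i <;> simp <;> norm_num

/-- The valuations at `S = (2, 3, 7)`: rows `[[2, 8, 1], [6, 6, 0], [1, 3, 3]]` for the points and `[6, 4, 3]` for
the base point `2T`. [cite: SilvermanAEC2009, Exercise 10.1(c)] -/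
theorem valuations :
    (∀ i j : Fin 3, padicValRat (![2, 3, 7] j) (![(183708 : ℚ), 46656, 18522] i) = ((![![2, 8, 1], ![6, 6, 0], ![1, 3, 3]] i j : ℕ) : ℤ)) ∧
    (∀ j : Fin 3, padicValRat (![2, 3, 7] j) ((1778112 : ℚ)) = ((![6, 4, 3] j : ℕ) : ℤ)) := by
  haveI : Fact (Nat.Prime 2) := ⟨Nat.prime_two⟩
  haveI : Fact (Nat.Prime 3) := ⟨Nat.prime_three⟩
  haveI : Fact (Nat.Prime 7) := ⟨by norm_num⟩
  refine ⟨fun i j ↦ ?_, fun j ↦ ?_⟩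
  · fin_cases i <;> fin_cases j
    · exact padicValRat_eq_of_eq (p := 2) 2 (u := 45927) (1) (Or.inl rfl) (by norm_num) (by norm_num)
    · exact padicValRat_eq_of_eq (p := 3) 8 (u := 28) (1) (Or.inl rfl) (by norm_num) (by norm_num)
    · exact padicValRat_eq_of_eq (p := 7) 1 (u := 26244) (1) (Or.inl rfl) (by norm_num) (by norm_num)
    · exact padicValRat_eq_of_eq (p := 2) 6 (u := 729) (1) (Or.inl rfl) (by norm_num) (by norm_num)
    · exact padicValRat_eq_of_eq (p := 3) 6 (u := 64) (1) (Or.inl rfl) (by norm_num) (by norm_num)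
    · exact padicValRat_eq_of_eq (p := 7) 0 (u := 46656) (1) (Or.inl rfl) (by norm_num) (by norm_num)
    · exact padicValRat_eq_of_eq (p := 2) 1 (u := 9261) (1) (Or.inl rfl) (by norm_num) (by norm_num)
    · exact padicValRat_eq_of_eq (p := 3) 3 (u := 686) (1) (Or.inl rfl) (by norm_num) (by norm_num)
    · exact padicValRat_eq_of_eq (p := 7) 3 (u := 54) (1) (Or.inl rfl) (by norm_num) (by norm_num)
  · fin_cases j
    · exact padicValRat_eq_of_eq (p := 2) 6 (u := 27783) (1) (Or.inl rfl) (by norm_num) (by norm_num)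
    · exact padicValRat_eq_of_eq (p := 3) 4 (u := 21952) (1) (Or.inl rfl) (by norm_num) (by norm_num)
    · exact padicValRat_eq_of_eq (p := 7) 3 (u := 5184) (1) (Or.inl rfl) (by norm_num) (by norm_num)

/-- **The valuation matrix mod `5` is invertible**: with `M_{ij} = v_{q_j} f_T(P_i) − v_{q_j} f_T(2T)`,
`M = [[1, 4, 3], [0, 2, 2], [0, 4, 0]]` mod `5` and `[[1, 1, 1], [0, 0, 4], [0, 3, 1]] · M = 1`, so `c ↦ c M` is onto `(ℤ/5)^3`. [folklore] -/
private theorem matrix_surjective : ∀ e : Fin 3 → ZMod 5, ∃ c : Fin 3 → ZMod 5, Matrix.vecMul c (Matrix.of (fun i j : Fin 3 ↦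
      ((padicValRat (![2, 3, 7] j) (![(0 : ℚ), -36, -42] i * ![(2268 : ℚ), 1296, 882] i -
          (((9 : ℤ) : ℚ)) * ![(0 : ℚ), -36, -42] i ^ 2 + (((9 : ℤ) : ℚ)) ^ 2 * ![(2268 : ℚ), 1296, 882] i) -
        padicValRat (![2, 3, 7] j) ((252 : ℚ) * 7056 - (((9 : ℤ) : ℚ)) * (252) ^ 2 +
          (((9 : ℤ) : ℚ)) ^ 2 * 7056) : ℤ) : ZMod 5))) = e := by
  have hM : Matrix.of (fun i j : Fin 3 ↦
      ((padicValRat (![2, 3, 7] j) (![(0 : ℚ), -36, -42] i * ![(2268 : ℚ), 1296, 882] i -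
          (((9 : ℤ) : ℚ)) * ![(0 : ℚ), -36, -42] i ^ 2 + (((9 : ℤ) : ℚ)) ^ 2 * ![(2268 : ℚ), 1296, 882] i) -
        padicValRat (![2, 3, 7] j) ((252 : ℚ) * 7056 - (((9 : ℤ) : ℚ)) * (252) ^ 2 +
          (((9 : ℤ) : ℚ)) ^ 2 * 7056) : ℤ) : ZMod 5)) =
      !![1, 4, 3; 0, 2, 2; 0, 4, 0] := by
    ext i j
    simp only [Matrix.of_apply]
    rw [kummerValues.1 i, kummerValues.2, valuations.1 i j, valuations.2 j]
    fin_cases i <;> fin_cases j <;> decide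
  have hinv : (!![1, 1, 1; 0, 0, 4; 0, 3, 1] : Matrix (Fin 3) (Fin 3) (ZMod 5)) *
      !![1, 4, 3; 0, 2, 2; 0, 4, 0] = 1 := by decide
  intro e
  refine ⟨Matrix.vecMul e !![1, 1, 1; 0, 0, 4; 0, 3, 1], ?_⟩
  rw [hM, Matrix.vecMul_vecMul, hinv, Matrix.vecMul_one]

/-- `S` is enumerated by `![2, 3, 7]`. [folklore] -/
private theorem primeFactors_enum :
    (∀ j : Fin 3, ![2, 3, 7] j ∈ ((28 : ℤ) * 9).natAbs.primeFactors) ∧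
    (∀ p ∈ ((28 : ℤ) * 9).natAbs.primeFactors, ∃ j : Fin 3, ![2, 3, 7] j = p) := by
  refine ⟨fun j ↦ ?_, fun p hp ↦ ?_⟩
  · rw [primeFactors_eq]; fin_cases j <;> simp
  · rw [primeFactors_eq] at hp
    simp only [Finset.mem_insert, Finset.mem_singleton] at hp
    rcases hp with rfl | rfl | rfl
    · exact ⟨0, rfl⟩
    · exact ⟨1, rfl⟩
    · exact ⟨2, rfl⟩

/-! ## §4 The theorems -/

/-- **`t₅(E_{28/9}) = 0`: `corank_{ℤ₅} Ш(E_{28/9}/ℚ)[5^∞] = 0`, UNCONDITIONALLY**, by the complete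
`5`-descent (`μ₅`-side box criterion of `KubertTateMuDescent`, tame régime, `3` points, rank `2`).
[cite: SilvermanAEC2009, Thm. X.4.2(a)] [cite: Fisher2001FiveSevenDescent, §2] -/
theorem shaCorank_five_eq_zero :
    haveI := isElliptic
    (kubertTateFive (((28 : ℤ) : ℚ)) (((9 : ℤ) : ℚ))).shaCorank 5 = 0 := by
  haveI := isElliptic
  haveI : Fact (Nat.Prime 11) := ⟨by norm_num⟩
  obtain ⟨h1, h2, h3, hb⟩ := nonsingular_points
  exact KubertTateMuDescent.shaCorank_five_eq_zero_of_matrix (28) 9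
    (toGeomPoints _ (.some (-36) 1296 h2)) (fun σ ↦ smul_toGeomPoints _ σ _)
    (KubertTateFiveTorsion.twentyfive_zsmul_toGeomPoints_ne_zero (28) 9 11 (by norm_num) (by norm_num)
      not_tor_dvd_Δ (by norm_num) (by norm_num))
    not_five_dvd_Δ tame ![2, 3, 7] primeFactors_enum.1 primeFactors_enum.2
    ![0, -36, -42] ![2268, 1296, 882]
    (fun i ↦ by fin_cases i <;> assumption)
    (fun i ↦ by fin_cases i <;> norm_num)
    252 7056 hb (by norm_num) matrix_surjective

/-- **`Ш(E_{28/9}/ℚ)[5] = 0`, unconditionally.** [cite: SilvermanAEC2009, Thm. X.4.2(a)] -/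
theorem sha_torsionBy_five_eq_bot :
    haveI := isElliptic
    (kubertTateFive (((28 : ℤ) : ℚ)) (((9 : ℤ) : ℚ))).sha[((5 : ℕ) : ℤ)] = ⊥ := by
  haveI := isElliptic
  haveI : Fact (Nat.Prime 11) := ⟨by norm_num⟩
  obtain ⟨h1, h2, h3, hb⟩ := nonsingular_points
  exact KubertTateMuDescent.sha_torsionBy_five_eq_bot_of_matrix (28) 9
    (toGeomPoints _ (.some (-36) 1296 h2)) (fun σ ↦ smul_toGeomPoints _ σ _)
    (KubertTateFiveTorsion.twentyfive_zsmul_toGeomPoints_ne_zero (28) 9 11 (by norm_num) (by norm_num)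
      not_tor_dvd_Δ (by norm_num) (by norm_num))
    not_five_dvd_Δ tame ![2, 3, 7] primeFactors_enum.1 primeFactors_enum.2
    ![0, -36, -42] ![2268, 1296, 882]
    (fun i ↦ by fin_cases i <;> assumption)
    (fun i ↦ by fin_cases i <;> norm_num)
    252 7056 hb (by norm_num) matrix_surjective

/-- **`Ш(E_{28/9}/ℚ)[5^∞] = 0`, unconditionally.** [cite: SilvermanAEC2009, Thm. X.4.2(a)] -/
theorem primaryComponent_sha_five_eq_bot :
    haveI := isElliptic
    AddCommGroup.primaryComponent (kubertTateFive (((28 : ℤ) : ℚ)) (((9 : ℤ) : ℚ))).sha 5 = ⊥ := by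
  haveI := isElliptic
  haveI : Fact (Nat.Prime 11) := ⟨by norm_num⟩
  obtain ⟨h1, h2, h3, hb⟩ := nonsingular_points
  exact KubertTateMuDescent.primaryComponent_sha_five_eq_bot_of_matrix (28) 9
    (toGeomPoints _ (.some (-36) 1296 h2)) (fun σ ↦ smul_toGeomPoints _ σ _)
    (KubertTateFiveTorsion.twentyfive_zsmul_toGeomPoints_ne_zero (28) 9 11 (by norm_num) (by norm_num)
      not_tor_dvd_Δ (by norm_num) (by norm_num))
    not_five_dvd_Δ tame ![2, 3, 7] primeFactors_enum.1 primeFactors_enum.2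
    ![0, -36, -42] ![2268, 1296, 882]
    (fun i ↦ by fin_cases i <;> assumption)
    (fun i ↦ by fin_cases i <;> norm_num)
    252 7056 hb (by norm_num) matrix_surjective

/-- **`rank E_{28/9}(ℚ) = 2`, unconditionally** (the `5`-descent computes the rank: box full, tame,
`#E(ℚ)[5] = 5` by reduction modulo `11`). [cite: SilvermanAEC2009, Thm. X.4.2 and Thm. X.1.1] -/
theorem mordellWeilRank_eq :
    haveI := isElliptic
    (kubertTateFive (((28 : ℤ) : ℚ)) (((9 : ℤ) : ℚ))).mordellWeilRank = 2 := by
  haveI := isElliptic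
  haveI : Fact (Nat.Prime 11) := ⟨by norm_num⟩
  obtain ⟨h1, h2, h3, hb⟩ := nonsingular_points
  have h := KubertTateMuDescent.mordellWeilRank_succ_eq_of_matrix (28) 9
    (toGeomPoints _ (.some (-36) 1296 h2)) (fun σ ↦ smul_toGeomPoints _ σ _)
    (KubertTateFiveTorsion.twentyfive_zsmul_toGeomPoints_ne_zero (28) 9 11 (by norm_num) (by norm_num)
      not_tor_dvd_Δ (by norm_num) (by norm_num))
    not_five_dvd_Δ tame ![2, 3, 7] primeFactors_enum.1 primeFactors_enum.2
    ![0, -36, -42] ![2268, 1296, 882]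
    (fun i ↦ by fin_cases i <;> assumption)
    (fun i ↦ by fin_cases i <;> norm_num)
    252 7056 hb (by norm_num) matrix_surjective
    (KubertTateFiveTorsion.natCard_torsionBy_five (28) 9 11 (by norm_num) (by norm_num) not_tor_dvd_Δ)
  have hc : (((28 : ℤ) * 9).natAbs.primeFactors).card = 3 := by
    rw [primeFactors_eq]; decide
  omega

end KubertTate289Descent

end Literature.NumberTheory.EllipticCurves

end
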